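import Mathlib
import Summits.NavierStokesRegularity.NavierStokesRegularity.Theorems.TypeIQuarterGateScarZoomDefs
import Summits.NavierStokesRegularity.NavierStokesRegularity.Theorems.TypeIQuarterGateSliceBudgetV7Defs
import Summits.NavierStokesRegularity.NavierStokesRegularity.Theorems.SymmetryModuliCountAxisymEndLiouville
import HarnessLib

/-!
# Crux `ScarEnvelopeTypeI` (stmt-NavierStokesRegularity-23843): the twin-scar wall has NO AXISYMMETRIC
  inhabitant (near-miss rung, by name from the proved crux 14061 `AxisymEndLiouville`)

The residual of both 23843 lines (scar_zoom S_C′ / slice_budget SK ≡ SD; KEY-NS #117) is the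
Albritton–Barker-class TWIN-SCAR Type-I ancient mild object (`ScarZoom.TwinScarObject M v`: KNSS-gauge
Type-I ancient mild, singular at the origin AND at a point of the unit sphere at the final time).  This
file records, BY NAME from the tree's PROVED crux `SymmetryModuliCount.AxisymEndLiouville` (14061,
`Theorems.AxisymEndLiouville_of`: a Type-I ancient mild field annihilated on a backward end by the
rotations about an axis vanishes there — KNSS 2009 Thm 5.2 lineage), that

* `eq_zero_of_infinitesimallyAxisymmetric` — a Type-I ancient mild field that is infinitesimally
  axisymmetric about ANY axis (skew `A ≠ 0`, any centre `c`) on the whole open past vanishes there;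
* `not_singularAt_of_infinitesimallyAxisymmetric` — hence it has NO final-time singular point
  (`ScarZoom.SingularAt`, the pointwise notion of the scar_zoom line) and no A–B backward singular
  point (`finalSingularSet U = ∅`, the slice_budget v7 notion);
* `twinScarObject_not_axisymmetric` — in particular NO twin-scar object is axisymmetric (about any
  axis whatsoever, through the scars or not): the wall's inhabitant, if any, is genuinely
  non-axisymmetric.

Census value only (an EXCLUDED STRATUM of the wall, like the self-similar stratum
`…SelfSimilarScar`); the wall itself (no twin-scar object at all) is OPEN.

HONEST FRAMING: nothing here proves `ScarEnvelopeTypeI`, SD/SK, or anything about Navier–Stokes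
regularity; 23843 is OPEN.  LEAD-lineage seat ns-sz-p1 g5, `--supports stmt-NavierStokesRegularity-23843 --as helper`.
-/

noncomputable section

set_option linter.dupNamespace false

namespace Summit.NavierStokesRegularity.NavierStokesRegularity.Cruxes.ScarEnvelopeTypeI.SliceBudget

open MeasureTheory Set Filter Topology Metric Function
open Literature.Analysis Literature.Analysis.FluidPDE
open Summit.NavierStokesRegularity.NavierStokesRegularity.Cruxes.ScarEnvelopeTypeI.ScarZoom
  (SingularAt TwinScarObject)

/-- **An infinitesimally axisymmetric Type-I ancient mild field vanishes on the open past** — the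
proved crux `AxisymEndLiouville` (14061) read at `θ = 0`. [cite: KochNadirashviliSereginSverak2009, Thm 5.2 (arXiv:0709.3599)] -/
theorem eq_zero_of_infinitesimallyAxisymmetric {M : ℝ}
    {U : ℝ → EuclideanSpace ℝ (Fin 3) → EuclideanSpace ℝ (Fin 3)} (hU : IsTypeIAncientMild M U)
    (c : EuclideanSpace ℝ (Fin 3)) (A : EuclideanSpace ℝ (Fin 3) →L[ℝ] EuclideanSpace ℝ (Fin 3))
    (hskew : ∀ x, inner ℝ (A x) x = 0) (hA : A ≠ 0)
    (hsym : ∀ t < (0 : ℝ), ∀ x, fderiv ℝ (U t) x (A (x - c)) - A (U t x) = 0) :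
    ∀ t < (0 : ℝ), ∀ x, U t x = 0 :=
  Summit.NavierStokesRegularity.NavierStokesRegularity.Theorems.AxisymEndLiouville_of M U hU c A 0
    hskew hA le_rfl hsym

/-- An infinitesimally axisymmetric Type-I ancient mild field has NO final-time scar in the
pointwise sense of line `scar_zoom` (`ScarZoom.SingularAt`). [folklore] -/
theorem not_singularAt_of_infinitesimallyAxisymmetric {M : ℝ}
    {U : ℝ → EuclideanSpace ℝ (Fin 3) → EuclideanSpace ℝ (Fin 3)} (hU : IsTypeIAncientMild M U)
    (c : EuclideanSpace ℝ (Fin 3)) (A : EuclideanSpace ℝ (Fin 3) →L[ℝ] EuclideanSpace ℝ (Fin 3))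
    (hskew : ∀ x, inner ℝ (A x) x = 0) (hA : A ≠ 0)
    (hsym : ∀ t < (0 : ℝ), ∀ x, fderiv ℝ (U t) x (A (x - c)) - A (U t x) = 0)
    (a : EuclideanSpace ℝ (Fin 3)) : ¬ SingularAt U a := by
  intro hsing
  obtain ⟨t, ht, y, -, hlt⟩ := hsing 1 one_pos 0
  have h0 := eq_zero_of_infinitesimallyAxisymmetric hU c A hskew hA hsym t ht.2 y
  rw [h0, norm_zero] at hlt
  exact lt_irrefl _ hlt

/-- An infinitesimally axisymmetric Type-I ancient mild field has EMPTY final-time singular set in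
the Albritton–Barker sense of line `slice_budget` v7 (`finalSingularSet`, backward-cylinder
`L^∞`-unboundedness): it vanishes on `Q_1(0, x)` for every `x`. [folklore] -/
theorem finalSingularSet_eq_empty_of_infinitesimallyAxisymmetric {M : ℝ}
    {U : ℝ → EuclideanSpace ℝ (Fin 3) → EuclideanSpace ℝ (Fin 3)} (hU : IsTypeIAncientMild M U)
    (c : EuclideanSpace ℝ (Fin 3)) (A : EuclideanSpace ℝ (Fin 3) →L[ℝ] EuclideanSpace ℝ (Fin 3))
    (hskew : ∀ x, inner ℝ (A x) x = 0) (hA : A ≠ 0)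
    (hsym : ∀ t < (0 : ℝ), ∀ x, fderiv ℝ (U t) x (A (x - c)) - A (U t x) = 0) :
    finalSingularSet U = ∅ := by
  ext x
  simp only [finalSingularSet, mem_setOf_eq, mem_empty_iff_false, iff_false]
  intro hsing
  have h1 := hsing 1 one_pos
  have hS : MeasurableSet (parabolicCylinder (1 : ℝ) (((0 : ℝ), x) : ℝ × EuclideanSpace ℝ (Fin 3))) :=
    (isOpen_parabolicCylinder _ _).measurableSet
  have hae : (uncurry U) =ᵐ[volume.restrict
      (parabolicCylinder (1 : ℝ) (((0 : ℝ), x) : ℝ × EuclideanSpace ℝ (Fin 3)))] 0 := by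
    refine (ae_restrict_iff' hS).2 (Eventually.of_forall fun z hz => ?_)
    obtain ⟨s, y⟩ := z
    have hs : s < 0 := by
      have := (mem_parabolicCylinder.1 hz).1.2
      simpa using this
    exact eq_zero_of_infinitesimallyAxisymmetric hU c A hskew hA hsym s hs y
  rw [eLpNorm_congr_ae hae, eLpNorm_zero] at h1
  exact ENNReal.zero_ne_top h1

/-- **No twin-scar object is axisymmetric.** The residual object of crux 23843 (scar_zoom S_C′ /
slice_budget SK) cannot be infinitesimally axisymmetric about any axis (any skew `A ≠ 0`, any centre
`c`): by `AxisymEndLiouville` it would vanish on the open past, contradicting its scar at the origin.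
Census stratum «axisymmetric» of the twin-scar wall: EMPTY. [folklore] -/
theorem twinScarObject_not_axisymmetric {M : ℝ}
    {v : ℝ → EuclideanSpace ℝ (Fin 3) → EuclideanSpace ℝ (Fin 3)} (hv : TwinScarObject M v)
    (c : EuclideanSpace ℝ (Fin 3)) (A : EuclideanSpace ℝ (Fin 3) →L[ℝ] EuclideanSpace ℝ (Fin 3))
    (hskew : ∀ x, inner ℝ (A x) x = 0) (hA : A ≠ 0) :
    ¬ ∀ t < (0 : ℝ), ∀ x, fderiv ℝ (v t) x (A (x - c)) - A (v t x) = 0 :=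
  fun hsym => not_singularAt_of_infinitesimallyAxisymmetric hv.1 c A hskew hA hsym 0 hv.2.2.1

end Summit.NavierStokesRegularity.NavierStokesRegularity.Cruxes.ScarEnvelopeTypeI.SliceBudget

end
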